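import Mathlib
import Summits.NavierStokesRegularity.NavierStokesRegularity.Theorems.SubOnsagerCeilingVirtualFloorChainCoupledFace
import Summits.NavierStokesRegularity.NavierStokesRegularity.Theorems.SubOnsagerCeilingGapSpecCertY1
import Summits.NavierStokesRegularity.NavierStokesRegularity.Theorems.SubOnsagerCeilingGapSpecCertY2
import Summits.NavierStokesRegularity.NavierStokesRegularity.Theorems.SubOnsagerCeilingGapSpecCertY3
import Summits.NavierStokesRegularity.NavierStokesRegularity.Theorems.SubOnsagerCeilingGapSpecCertY4
import Summits.NavierStokesRegularity.NavierStokesRegularity.Theorems.SubOnsagerCeilingGapSpecCertY5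
import HarnessLib

/-!
# TOPOLOGY-AS-A-DATUM ROUTE, worked instance: the chain barrier on the slice `b ∈ [253/200, 127/100]` from the spec-list design `dY`
(helper file for crux stmt-NavierStokesRegularity-27057 `SubOnsagerCeiling.ForwardTailCeilingKP`, `--supports … --as helper`;
LEAD SOC g12, line «kp-shell-barrier»)

Assembly exactly as `SubOnsagerCeilingGapSpecSliceP` (see its docstring for (i)–(iv)): `specSliceY_consts`, `hFace` via `GapSpec.inertial_of_cert`
(bound `−1/4096`) / `damping_of_cert` / `Spec.face_damping`, `design_init`, `design_safe`, then `chain_le_of_coupledFaceCertB` (ι = `Fin 17`) gives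
`spec_gap_chain_Y`. HONEST FRAMING: MODEL lattice (route SubOnsagerCeiling, TL-M2Break); nothing here bears on Navier–Stokes regularity;
27057 stays OPEN. [cite: BarbatoMorandinRomito2011, §2 Lemma 2.1, §3.2] [cite: Tao2016AveragedNS, §4 (4.5), (4.13)]
-/

noncomputable section

-- the sub-problem namespace `NavierStokesRegularity.NavierStokesRegularity` is the tree's layout (D-0017)
set_option linter.dupNamespace false

namespace Summit.NavierStokesRegularity.NavierStokesRegularity.Theorems.VirtualFloor.GapSpec

open Set Filter Topology
open Literature.Analysis.ValidatedNumerics KernelFaceMul KernelFaceAffine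
open Summit.NavierStokesRegularity.NavierStokesRegularity.Theorems.VirtualFloor
open Summit.NavierStokesRegularity.NavierStokesRegularity.Theorems.VirtualFloor.GapRung (pt pt_mem_box9)

/-- The three rescaling constants lie in the slice box. [folklore] -/
theorem specSliceY_consts {b : ℝ} (hb : (253 / 200 : ℝ) ≤ b) (hb' : b ≤ (127 / 100 : ℝ)) :
    (((79917 / 50000 : ℚ) : ℝ) ≤ (b ^ ((5 : ℝ) / 2) / b ^ ((101 : ℝ) / 200)) ∧ (b ^ ((5 : ℝ) / 2) / b ^ ((101 : ℝ) / 200)) ≤ ((80549 / 50000 : ℚ) : ℝ)) ∧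
    (((63027 / 50000 : ℚ) : ℝ) ≤ (b ^ ((5 : ℝ) / 2) / (b ^ ((101 : ℝ) / 200)) ^ 3) ∧ (b ^ ((5 : ℝ) / 2) / (b ^ ((101 : ℝ) / 200)) ^ 3) ≤ ((63273 / 50000 : ℚ) : ℝ)) ∧
    (((64009 / 40000 : ℚ) : ℝ) ≤ b ^ 2 ∧ b ^ 2 ≤ ((16129 / 10000 : ℚ) : ℝ)) := by
  have hb0 : 0 < b := by linarith
  have hL : (b ^ ((5 : ℝ) / 2) / b ^ ((101 : ℝ) / 200)) = b ^ ((399 : ℝ) / 200) := by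
    rw [← Real.rpow_sub hb0]; norm_num
  have hp : (b ^ ((5 : ℝ) / 2) / (b ^ ((101 : ℝ) / 200)) ^ 3) = b ^ ((197 : ℝ) / 200) := by
    rw [← Real.rpow_natCast, ← Real.rpow_mul hb0.le, ← Real.rpow_sub hb0]; norm_num
  rw [hL, hp]
  refine ⟨⟨specSliceY_L_lo.trans (Real.rpow_le_rpow (by norm_num) hb (by norm_num)),
    (Real.rpow_le_rpow hb0.le hb' (by norm_num)).trans specSliceY_L_hi⟩,
    ⟨specSliceY_p_lo.trans (Real.rpow_le_rpow (by norm_num) hb (by norm_num)),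
    (Real.rpow_le_rpow hb0.le hb' (by norm_num)).trans specSliceY_p_hi⟩, ?_, ?_⟩
  · push_cast; nlinarith
  · push_cast; nlinarith

/-- Every face of `dY` satisfies `InitOK`. [folklore] -/
theorem dY_initOK : ∀ k, (dY k).InitOK := by
  intro k; fin_cases k
  · exact dY_initOK_0
  · exact dY_initOK_1
  · exact dY_initOK_2
  · exact dY_initOK_3
  · exact dY_initOK_4
  · exact dY_initOK_5
  · exact dY_initOK_6
  · exact dY_initOK_7
  · exact dY_initOK_8
  · exact dY_initOK_9
  · exact dY_initOK_10
  · exact dY_initOK_11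
  · exact dY_initOK_12
  · exact dY_initOK_13
  · exact dY_initOK_14
  · exact dY_initOK_15
  · exact dY_initOK_16

/-- **`hFace` for `dY` at every `b ∈ [253/200, 127/100]`.** [cite: BarbatoMorandinRomito2011, §2 Lemma 2.1] -/
theorem specSliceY_hFace {b : ℝ} (hb : (253 / 200 : ℝ) ≤ b) (hb' : b ≤ (127 / 100 : ℝ)) :
    ∀ k (x : Fin 4 → ℝ) (v z : ℝ), (∀ i, 0 ≤ x i) → 0 ≤ v → 0 ≤ z → (∀ i, x i ≤ (49 / 50 : ℝ)) → v ≤ (49 / 50 : ℝ) →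
      z ≤ (49 / 50 : ℝ) → (∀ k', (dY k').face x ≤ 0) → (∀ k', (dY k').face (vec4 v (x 0) (x 1) (x 2)) ≤ 0) →
      (∀ k', (dY k').face (vec4 (x 1) (x 2) (x 3) z) ≤ 0) → (dY k).face x = 0 →
      ((dY k).grad 0 x * (v ^ 2 - (b ^ ((5 : ℝ) / 2) / (b ^ ((101 : ℝ) / 200)) ^ 3) * x 0 * x 1) +
          (dY k).grad 1 x * ((b ^ ((5 : ℝ) / 2) / b ^ ((101 : ℝ) / 200)) * (x 0 ^ 2 - (b ^ ((5 : ℝ) / 2) / (b ^ ((101 : ℝ) / 200)) ^ 3) * x 1 * x 2)) +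
          (dY k).grad 2 x * ((b ^ ((5 : ℝ) / 2) / b ^ ((101 : ℝ) / 200)) ^ 2 * (x 1 ^ 2 - (b ^ ((5 : ℝ) / 2) / (b ^ ((101 : ℝ) / 200)) ^ 3) * x 2 * x 3)) +
          (dY k).grad 3 x * ((b ^ ((5 : ℝ) / 2) / b ^ ((101 : ℝ) / 200)) ^ 3 * (x 2 ^ 2 - (b ^ ((5 : ℝ) / 2) / (b ^ ((101 : ℝ) / 200)) ^ 3) * x 3 * z)) < 0) ∧
      0 ≤ (dY k).grad 0 x * x 0 + (dY k).grad 1 x * ((b ^ 2) * x 1) + (dY k).grad 2 x * ((b ^ 2) ^ 2 * x 2) +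
        (dY k).grad 3 x * ((b ^ 2) ^ 3 * x 3) := by
  intro k x v z h0 hv0 hz0 hc hvc hzc hX hLo hUp hk
  obtain ⟨hL, hp, hb2⟩ := specSliceY_consts hb hb'
  have hmem := pt_mem_box9 h0 hc hv0 hvc hz0 hzc hL hp hb2
  refine ⟨?_, ?_⟩
  · fin_cases k
    · exact inertial_of_cert (D := dY) (k := 0) dY_elimOK_0 cert_dY_Y_cap1 (by norm_num) hmem h0 hc hX hLo hUp hk
    · exact inertial_of_cert (D := dY) (k := 1) dY_elimOK_1 cert_dY_Y_cap2 (by norm_num) hmem h0 hc hX hLo hUp hk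
    · exact inertial_of_cert (D := dY) (k := 2) dY_elimOK_2 cert_dY_Y_cap3 (by norm_num) hmem h0 hc hX hLo hUp hk
    · exact inertial_of_cert (D := dY) (k := 3) dY_elimOK_3 cert_dY_Y_cub0 (by norm_num) hmem h0 hc hX hLo hUp hk
    · rcases Box.mem_split hmem 1 (49/100) with hmem' | hmem'
      · exact inertial_of_cert (D := dY) (k := 4) dY_elimOK_4 cert_dY_Y_cub1_1 (by norm_num) hmem' h0 hc hX hLo hUp hk
      · exact inertial_of_cert (D := dY) (k := 4) dY_elimOK_4 cert_dY_Y_cub1_2 (by norm_num) hmem' h0 hc hX hLo hUp hk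
    · rcases Box.mem_split hmem 2 (49/100) with hmem' | hmem'
      · exact inertial_of_cert (D := dY) (k := 5) dY_elimOK_5 cert_dY_Y_cub2_1 (by norm_num) hmem' h0 hc hX hLo hUp hk
      · rcases Box.mem_split hmem' 2 (147/200) with hmem'' | hmem''
        · exact inertial_of_cert (D := dY) (k := 5) dY_elimOK_5 cert_dY_Y_cub2_2 (by norm_num) hmem'' h0 hc hX hLo hUp hk
        · exact inertial_of_cert (D := dY) (k := 5) dY_elimOK_5 cert_dY_Y_cub2_3 (by norm_num) hmem'' h0 hc hX hLo hUp hk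
    · exact inertial_of_cert (D := dY) (k := 6) dY_elimOK_6 cert_dY_Y_capA (by norm_num) hmem h0 hc hX hLo hUp hk
    · exact inertial_of_cert (D := dY) (k := 7) dY_elimOK_7 cert_dY_Y_capB (by norm_num) hmem h0 hc hX hLo hUp hk
    · rcases Box.mem_split hmem 2 (49/100) with hmem' | hmem'
      · exact inertial_of_cert (D := dY) (k := 8) dY_elimOK_8 cert_dY_Y_bulk_1 (by norm_num) hmem' h0 hc hX hLo hUp hk
      · rcases Box.mem_split hmem' 2 (147/200) with hmem'' | hmem''
        · exact inertial_of_cert (D := dY) (k := 8) dY_elimOK_8 cert_dY_Y_bulk_2 (by norm_num) hmem'' h0 hc hX hLo hUp hk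
        · rcases Box.mem_split hmem'' 1 (49/100) with hmem''' | hmem'''
          · exact inertial_of_cert (D := dY) (k := 8) dY_elimOK_8 cert_dY_Y_bulk_3 (by norm_num) hmem''' h0 hc hX hLo hUp hk
          · rcases Box.mem_split hmem''' 2 (343/400) with hmem'''' | hmem''''
            · rcases Box.mem_split hmem'''' 1 (147/200) with hmem''''' | hmem'''''
              · exact inertial_of_cert (D := dY) (k := 8) dY_elimOK_8 cert_dY_Y_bulk_4 (by norm_num) hmem''''' h0 hc hX hLo hUp hk
              · rcases Box.mem_split hmem''''' 2 (637/800) with hmem'''''' | hmem''''''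
                · exact inertial_of_cert (D := dY) (k := 8) dY_elimOK_8 cert_dY_Y_bulk_5 (by norm_num) hmem'''''' h0 hc hX hLo hUp hk
                · rcases Box.mem_split hmem'''''' 1 (343/400) with hmem''''''' | hmem'''''''
                  · exact inertial_of_cert (D := dY) (k := 8) dY_elimOK_8 cert_dY_Y_bulk_6 (by norm_num) hmem''''''' h0 hc hX hLo hUp hk
                  · rcases Box.mem_split hmem''''''' 0 (49/100) with hmem'''''''' | hmem''''''''
                    · exact inertial_of_cert (D := dY) (k := 8) dY_elimOK_8 cert_dY_Y_bulk_7 (by norm_num) hmem'''''''' h0 hc hX hLo hUp hk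
                    · rcases Box.mem_split hmem'''''''' 2 (1323/1600) with hmem''''''''' | hmem'''''''''
                      · exact inertial_of_cert (D := dY) (k := 8) dY_elimOK_8 cert_dY_Y_bulk_8 (by norm_num) hmem''''''''' h0 hc hX hLo hUp hk
                      · exact inertial_of_cert (D := dY) (k := 8) dY_elimOK_8 cert_dY_Y_bulk_9 (by norm_num) hmem''''''''' h0 hc hX hLo hUp hk
            · rcases Box.mem_split hmem'''' 1 (147/200) with hmem''''' | hmem'''''
              · exact inertial_of_cert (D := dY) (k := 8) dY_elimOK_8 cert_dY_Y_bulk_10 (by norm_num) hmem''''' h0 hc hX hLo hUp hk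
              · rcases Box.mem_split hmem''''' 2 (147/160) with hmem'''''' | hmem''''''
                · exact inertial_of_cert (D := dY) (k := 8) dY_elimOK_8 cert_dY_Y_bulk_11 (by norm_num) hmem'''''' h0 hc hX hLo hUp hk
                · exact inertial_of_cert (D := dY) (k := 8) dY_elimOK_8 cert_dY_Y_bulk_12 (by norm_num) hmem'''''' h0 hc hX hLo hUp hk
    · rcases Box.mem_split hmem 2 (49/100) with hmem' | hmem'
      · rcases Box.mem_split hmem' 2 (49/200) with hmem'' | hmem''
        · rcases Box.mem_split hmem'' 2 (49/400) with hmem''' | hmem'''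
          · exact inertial_of_cert (D := dY) (k := 9) dY_elimOK_9 cert_dY_Y_carve_1 (by norm_num) hmem''' h0 hc hX hLo hUp hk
          · rcases Box.mem_split hmem''' 1 (49/100) with hmem'''' | hmem''''
            · exact inertial_of_cert (D := dY) (k := 9) dY_elimOK_9 cert_dY_Y_carve_2 (by norm_num) hmem'''' h0 hc hX hLo hUp hk
            · rcases Box.mem_split hmem'''' 2 (147/800) with hmem''''' | hmem'''''
              · exact inertial_of_cert (D := dY) (k := 9) dY_elimOK_9 cert_dY_Y_carve_3 (by norm_num) hmem''''' h0 hc hX hLo hUp hk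
              · exact inertial_of_cert (D := dY) (k := 9) dY_elimOK_9 cert_dY_Y_carve_4 (by norm_num) hmem''''' h0 hc hX hLo hUp hk
        · rcases Box.mem_split hmem'' 1 (49/100) with hmem''' | hmem'''
          · exact inertial_of_cert (D := dY) (k := 9) dY_elimOK_9 cert_dY_Y_carve_5 (by norm_num) hmem''' h0 hc hX hLo hUp hk
          · rcases Box.mem_split hmem''' 2 (147/400) with hmem'''' | hmem''''
            · rcases Box.mem_split hmem'''' 1 (147/200) with hmem''''' | hmem'''''
              · exact inertial_of_cert (D := dY) (k := 9) dY_elimOK_9 cert_dY_Y_carve_6 (by norm_num) hmem''''' h0 hc hX hLo hUp hk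
              · rcases Box.mem_split hmem''''' 2 (49/160) with hmem'''''' | hmem''''''
                · exact inertial_of_cert (D := dY) (k := 9) dY_elimOK_9 cert_dY_Y_carve_7 (by norm_num) hmem'''''' h0 hc hX hLo hUp hk
                · exact inertial_of_cert (D := dY) (k := 9) dY_elimOK_9 cert_dY_Y_carve_8 (by norm_num) hmem'''''' h0 hc hX hLo hUp hk
            · exact inertial_of_cert (D := dY) (k := 9) dY_elimOK_9 cert_dY_Y_carve_9 (by norm_num) hmem'''' h0 hc hX hLo hUp hk
      · rcases Box.mem_split hmem' 2 (147/200) with hmem'' | hmem''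
        · rcases Box.mem_split hmem'' 2 (49/80) with hmem''' | hmem'''
          · rcases Box.mem_split hmem''' 5 (49/100) with hmem'''' | hmem''''
            · exact inertial_of_cert (D := dY) (k := 9) dY_elimOK_9 cert_dY_Y_carve_10 (by norm_num) hmem'''' h0 hc hX hLo hUp hk
            · rcases Box.mem_split hmem'''' 1 (49/100) with hmem''''' | hmem'''''
              · exact inertial_of_cert (D := dY) (k := 9) dY_elimOK_9 cert_dY_Y_carve_11 (by norm_num) hmem''''' h0 hc hX hLo hUp hk
              · rcases Box.mem_split hmem''''' 1 (147/200) with hmem'''''' | hmem''''''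
                · exact inertial_of_cert (D := dY) (k := 9) dY_elimOK_9 cert_dY_Y_carve_12 (by norm_num) hmem'''''' h0 hc hX hLo hUp hk
                · rcases Box.mem_split hmem'''''' 0 (49/100) with hmem''''''' | hmem'''''''
                  · exact inertial_of_cert (D := dY) (k := 9) dY_elimOK_9 cert_dY_Y_carve_13 (by norm_num) hmem''''''' h0 hc hX hLo hUp hk
                  · rcases Box.mem_split hmem''''''' 0 (147/200) with hmem'''''''' | hmem''''''''
                    · exact inertial_of_cert (D := dY) (k := 9) dY_elimOK_9 cert_dY_Y_carve_14 (by norm_num) hmem'''''''' h0 hc hX hLo hUp hk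
                    · rcases Box.mem_split hmem'''''''' 0 (343/400) with hmem''''''''' | hmem'''''''''
                      · exact inertial_of_cert (D := dY) (k := 9) dY_elimOK_9 cert_dY_Y_carve_15 (by norm_num) hmem''''''''' h0 hc hX hLo hUp hk
                      · exact inertial_of_cert (D := dY) (k := 9) dY_elimOK_9 cert_dY_Y_carve_16 (by norm_num) hmem''''''''' h0 hc hX hLo hUp hk
          · rcases Box.mem_split hmem''' 0 (49/100) with hmem'''' | hmem''''
            · exact inertial_of_cert (D := dY) (k := 9) dY_elimOK_9 cert_dY_Y_carve_17 (by norm_num) hmem'''' h0 hc hX hLo hUp hk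
            · rcases Box.mem_split hmem'''' 0 (147/200) with hmem''''' | hmem'''''
              · exact inertial_of_cert (D := dY) (k := 9) dY_elimOK_9 cert_dY_Y_carve_18 (by norm_num) hmem''''' h0 hc hX hLo hUp hk
              · rcases Box.mem_split hmem''''' 5 (49/100) with hmem'''''' | hmem''''''
                · rcases Box.mem_split hmem'''''' 1 (49/100) with hmem''''''' | hmem'''''''
                  · exact inertial_of_cert (D := dY) (k := 9) dY_elimOK_9 cert_dY_Y_carve_19 (by norm_num) hmem''''''' h0 hc hX hLo hUp hk
                  · rcases Box.mem_split hmem''''''' 0 (343/400) with hmem'''''''' | hmem''''''''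
                    · exact inertial_of_cert (D := dY) (k := 9) dY_elimOK_9 cert_dY_Y_carve_20 (by norm_num) hmem'''''''' h0 hc hX hLo hUp hk
                    · rcases Box.mem_split hmem'''''''' 1 (147/200) with hmem''''''''' | hmem'''''''''
                      · exact inertial_of_cert (D := dY) (k := 9) dY_elimOK_9 cert_dY_Y_carve_21 (by norm_num) hmem''''''''' h0 hc hX hLo hUp hk
                      · rcases Box.mem_split hmem''''''''' 2 (539/800) with hmem'''''''''' | hmem''''''''''
                        · exact inertial_of_cert (D := dY) (k := 9) dY_elimOK_9 cert_dY_Y_carve_22 (by norm_num) hmem'''''''''' h0 hc hX hLo hUp hk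
                        · rcases Box.mem_split hmem'''''''''' 2 (1127/1600) with hmem''''''''''' | hmem'''''''''''
                          · exact inertial_of_cert (D := dY) (k := 9) dY_elimOK_9 cert_dY_Y_carve_23 (by norm_num) hmem''''''''''' h0 hc hX hLo hUp hk
                          · rcases Box.mem_split hmem''''''''''' 1 (343/400) with hmem'''''''''''' | hmem''''''''''''
                            · exact inertial_of_cert (D := dY) (k := 9) dY_elimOK_9 cert_dY_Y_carve_24 (by norm_num) hmem'''''''''''' h0 hc hX hLo hUp hk
                            · rcases Box.mem_split hmem'''''''''''' 0 (147/160) with hmem''''''''''''' | hmem'''''''''''''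
                              · exact inertial_of_cert (D := dY) (k := 9) dY_elimOK_9 cert_dY_Y_carve_25 (by norm_num) hmem''''''''''''' h0 hc hX hLo hUp hk
                              · rcases Box.mem_split hmem''''''''''''' 1 (147/160) with hmem'''''''''''''' | hmem''''''''''''''
                                · rcases Box.mem_split hmem'''''''''''''' 2 (2303/3200) with hmem''''''''''''''' | hmem'''''''''''''''
                                  · exact inertial_of_cert (D := dY) (k := 9) dY_elimOK_9 cert_dY_Y_carve_26 (by norm_num) hmem''''''''''''''' h0 hc hX hLo hUp hk
                                  · exact inertial_of_cert (D := dY) (k := 9) dY_elimOK_9 cert_dY_Y_carve_27 (by norm_num) hmem''''''''''''''' h0 hc hX hLo hUp hk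
                                · exact inertial_of_cert (D := dY) (k := 9) dY_elimOK_9 cert_dY_Y_carve_28 (by norm_num) hmem'''''''''''''' h0 hc hX hLo hUp hk
                · rcases Box.mem_split hmem'''''' 1 (49/100) with hmem''''''' | hmem'''''''
                  · exact inertial_of_cert (D := dY) (k := 9) dY_elimOK_9 cert_dY_Y_carve_29 (by norm_num) hmem''''''' h0 hc hX hLo hUp hk
                  · rcases Box.mem_split hmem''''''' 1 (147/200) with hmem'''''''' | hmem''''''''
                    · exact inertial_of_cert (D := dY) (k := 9) dY_elimOK_9 cert_dY_Y_carve_30 (by norm_num) hmem'''''''' h0 hc hX hLo hUp hk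
                    · rcases Box.mem_split hmem'''''''' 0 (343/400) with hmem''''''''' | hmem'''''''''
                      · exact inertial_of_cert (D := dY) (k := 9) dY_elimOK_9 cert_dY_Y_carve_31 (by norm_num) hmem''''''''' h0 hc hX hLo hUp hk
                      · rcases Box.mem_split hmem''''''''' 2 (539/800) with hmem'''''''''' | hmem''''''''''
                        · rcases Box.mem_split hmem'''''''''' 1 (343/400) with hmem''''''''''' | hmem'''''''''''
                          · exact inertial_of_cert (D := dY) (k := 9) dY_elimOK_9 cert_dY_Y_carve_32 (by norm_num) hmem''''''''''' h0 hc hX hLo hUp hk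
                          · rcases Box.mem_split hmem''''''''''' 0 (147/160) with hmem'''''''''''' | hmem''''''''''''
                            · exact inertial_of_cert (D := dY) (k := 9) dY_elimOK_9 cert_dY_Y_carve_33 (by norm_num) hmem'''''''''''' h0 hc hX hLo hUp hk
                            · exact inertial_of_cert (D := dY) (k := 9) dY_elimOK_9 cert_dY_Y_carve_34 (by norm_num) hmem'''''''''''' h0 hc hX hLo hUp hk
                        · rcases Box.mem_split hmem'''''''''' 0 (147/160) with hmem''''''''''' | hmem'''''''''''
                          · exact inertial_of_cert (D := dY) (k := 9) dY_elimOK_9 cert_dY_Y_carve_35 (by norm_num) hmem''''''''''' h0 hc hX hLo hUp hk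
                          · exact inertial_of_cert (D := dY) (k := 9) dY_elimOK_9 cert_dY_Y_carve_36 (by norm_num) hmem''''''''''' h0 hc hX hLo hUp hk
        · rcases Box.mem_split hmem'' 2 (343/400) with hmem''' | hmem'''
          · rcases Box.mem_split hmem''' 1 (49/100) with hmem'''' | hmem''''
            · exact inertial_of_cert (D := dY) (k := 9) dY_elimOK_9 cert_dY_Y_carve_37 (by norm_num) hmem'''' h0 hc hX hLo hUp hk
            · rcases Box.mem_split hmem'''' 0 (49/100) with hmem''''' | hmem'''''
              · exact inertial_of_cert (D := dY) (k := 9) dY_elimOK_9 cert_dY_Y_carve_38 (by norm_num) hmem''''' h0 hc hX hLo hUp hk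
              · rcases Box.mem_split hmem''''' 2 (637/800) with hmem'''''' | hmem''''''
                · rcases Box.mem_split hmem'''''' 0 (147/200) with hmem''''''' | hmem'''''''
                  · exact inertial_of_cert (D := dY) (k := 9) dY_elimOK_9 cert_dY_Y_carve_39 (by norm_num) hmem''''''' h0 hc hX hLo hUp hk
                  · rcases Box.mem_split hmem''''''' 1 (147/200) with hmem'''''''' | hmem''''''''
                    · exact inertial_of_cert (D := dY) (k := 9) dY_elimOK_9 cert_dY_Y_carve_40 (by norm_num) hmem'''''''' h0 hc hX hLo hUp hk
                    · rcases Box.mem_split hmem'''''''' 2 (49/64) with hmem''''''''' | hmem'''''''''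
                      · rcases Box.mem_split hmem''''''''' 0 (343/400) with hmem'''''''''' | hmem''''''''''
                        · exact inertial_of_cert (D := dY) (k := 9) dY_elimOK_9 cert_dY_Y_carve_41 (by norm_num) hmem'''''''''' h0 hc hX hLo hUp hk
                        · rcases Box.mem_split hmem'''''''''' 0 (147/160) with hmem''''''''''' | hmem'''''''''''
                          · exact inertial_of_cert (D := dY) (k := 9) dY_elimOK_9 cert_dY_Y_carve_42 (by norm_num) hmem''''''''''' h0 hc hX hLo hUp hk
                          · exact inertial_of_cert (D := dY) (k := 9) dY_elimOK_9 cert_dY_Y_carve_43 (by norm_num) hmem''''''''''' h0 hc hX hLo hUp hk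
                      · exact inertial_of_cert (D := dY) (k := 9) dY_elimOK_9 cert_dY_Y_carve_44 (by norm_num) hmem''''''''' h0 hc hX hLo hUp hk
                · exact inertial_of_cert (D := dY) (k := 9) dY_elimOK_9 cert_dY_Y_carve_45 (by norm_num) hmem'''''' h0 hc hX hLo hUp hk
          · exact inertial_of_cert (D := dY) (k := 9) dY_elimOK_9 cert_dY_Y_carve_46 (by norm_num) hmem''' h0 hc hX hLo hUp hk
    · exact inertial_of_cert (D := dY) (k := 10) dY_elimOK_10 cert_dY_Y_rat0 (by norm_num) hmem h0 hc hX hLo hUp hk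
    · exact inertial_of_cert (D := dY) (k := 11) dY_elimOK_11 cert_dY_Y_rat1 (by norm_num) hmem h0 hc hX hLo hUp hk
    · exact inertial_of_cert (D := dY) (k := 12) dY_elimOK_12 cert_dY_Y_rat2 (by norm_num) hmem h0 hc hX hLo hUp hk
    · rcases Box.mem_split hmem 2 (49/100) with hmem' | hmem'
      · rcases Box.mem_split hmem' 1 (49/100) with hmem'' | hmem''
        · rcases Box.mem_split hmem'' 2 (49/200) with hmem''' | hmem'''
          · exact inertial_of_cert (D := dY) (k := 13) dY_elimOK_13 cert_dY_Y_rat3_1 (by norm_num) hmem''' h0 hc hX hLo hUp hk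
          · rcases Box.mem_split hmem''' 2 (147/400) with hmem'''' | hmem''''
            · exact inertial_of_cert (D := dY) (k := 13) dY_elimOK_13 cert_dY_Y_rat3_2 (by norm_num) hmem'''' h0 hc hX hLo hUp hk
            · rcases Box.mem_split hmem'''' 1 (49/200) with hmem''''' | hmem'''''
              · exact inertial_of_cert (D := dY) (k := 13) dY_elimOK_13 cert_dY_Y_rat3_3 (by norm_num) hmem''''' h0 hc hX hLo hUp hk
              · rcases Box.mem_split hmem''''' 1 (147/400) with hmem'''''' | hmem''''''
                · rcases Box.mem_split hmem'''''' 2 (343/800) with hmem''''''' | hmem'''''''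
                  · exact inertial_of_cert (D := dY) (k := 13) dY_elimOK_13 cert_dY_Y_rat3_4 (by norm_num) hmem''''''' h0 hc hX hLo hUp hk
                  · exact inertial_of_cert (D := dY) (k := 13) dY_elimOK_13 cert_dY_Y_rat3_5 (by norm_num) hmem''''''' h0 hc hX hLo hUp hk
                · exact inertial_of_cert (D := dY) (k := 13) dY_elimOK_13 cert_dY_Y_rat3_6 (by norm_num) hmem'''''' h0 hc hX hLo hUp hk
        · exact inertial_of_cert (D := dY) (k := 13) dY_elimOK_13 cert_dY_Y_rat3_7 (by norm_num) hmem'' h0 hc hX hLo hUp hk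
      · rcases Box.mem_split hmem' 2 (147/200) with hmem'' | hmem''
        · rcases Box.mem_split hmem'' 1 (49/100) with hmem''' | hmem'''
          · exact inertial_of_cert (D := dY) (k := 13) dY_elimOK_13 cert_dY_Y_rat3_8 (by norm_num) hmem''' h0 hc hX hLo hUp hk
          · exact inertial_of_cert (D := dY) (k := 13) dY_elimOK_13 cert_dY_Y_rat3_9 (by norm_num) hmem''' h0 hc hX hLo hUp hk
        · exact inertial_of_cert (D := dY) (k := 13) dY_elimOK_13 cert_dY_Y_rat3_10 (by norm_num) hmem'' h0 hc hX hLo hUp hk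
    · rcases Box.mem_split hmem 2 (49/100) with hmem' | hmem'
      · rcases Box.mem_split hmem' 2 (49/200) with hmem'' | hmem''
        · exact inertial_of_cert (D := dY) (k := 14) dY_elimOK_14 cert_dY_Y_hq_1 (by norm_num) hmem'' h0 hc hX hLo hUp hk
        · exact inertial_of_cert (D := dY) (k := 14) dY_elimOK_14 cert_dY_Y_hq_2 (by norm_num) hmem'' h0 hc hX hLo hUp hk
      · rcases Box.mem_split hmem' 2 (147/200) with hmem'' | hmem''
        · rcases Box.mem_split hmem'' 1 (49/100) with hmem''' | hmem'''
          · exact inertial_of_cert (D := dY) (k := 14) dY_elimOK_14 cert_dY_Y_hq_3 (by norm_num) hmem''' h0 hc hX hLo hUp hk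
          · rcases Box.mem_split hmem''' 2 (49/80) with hmem'''' | hmem''''
            · exact inertial_of_cert (D := dY) (k := 14) dY_elimOK_14 cert_dY_Y_hq_4 (by norm_num) hmem'''' h0 hc hX hLo hUp hk
            · rcases Box.mem_split hmem'''' 2 (539/800) with hmem''''' | hmem'''''
              · rcases Box.mem_split hmem''''' 1 (147/200) with hmem'''''' | hmem''''''
                · rcases Box.mem_split hmem'''''' 0 (49/100) with hmem''''''' | hmem'''''''
                  · rcases Box.mem_split hmem''''''' 2 (1029/1600) with hmem'''''''' | hmem''''''''
                    · exact inertial_of_cert (D := dY) (k := 14) dY_elimOK_14 cert_dY_Y_hq_5 (by norm_num) hmem'''''''' h0 hc hX hLo hUp hk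
                    · exact inertial_of_cert (D := dY) (k := 14) dY_elimOK_14 cert_dY_Y_hq_6 (by norm_num) hmem'''''''' h0 hc hX hLo hUp hk
                  · exact inertial_of_cert (D := dY) (k := 14) dY_elimOK_14 cert_dY_Y_hq_7 (by norm_num) hmem''''''' h0 hc hX hLo hUp hk
                · exact inertial_of_cert (D := dY) (k := 14) dY_elimOK_14 cert_dY_Y_hq_8 (by norm_num) hmem'''''' h0 hc hX hLo hUp hk
              · rcases Box.mem_split hmem''''' 1 (147/200) with hmem'''''' | hmem''''''
                · rcases Box.mem_split hmem'''''' 0 (49/100) with hmem''''''' | hmem'''''''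
                  · rcases Box.mem_split hmem''''''' 1 (49/80) with hmem'''''''' | hmem''''''''
                    · exact inertial_of_cert (D := dY) (k := 14) dY_elimOK_14 cert_dY_Y_hq_9 (by norm_num) hmem'''''''' h0 hc hX hLo hUp hk
                    · exact inertial_of_cert (D := dY) (k := 14) dY_elimOK_14 cert_dY_Y_hq_10 (by norm_num) hmem'''''''' h0 hc hX hLo hUp hk
                  · exact inertial_of_cert (D := dY) (k := 14) dY_elimOK_14 cert_dY_Y_hq_11 (by norm_num) hmem''''''' h0 hc hX hLo hUp hk
                · exact inertial_of_cert (D := dY) (k := 14) dY_elimOK_14 cert_dY_Y_hq_12 (by norm_num) hmem'''''' h0 hc hX hLo hUp hk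
        · rcases Box.mem_split hmem'' 1 (49/100) with hmem''' | hmem'''
          · exact inertial_of_cert (D := dY) (k := 14) dY_elimOK_14 cert_dY_Y_hq_13 (by norm_num) hmem''' h0 hc hX hLo hUp hk
          · rcases Box.mem_split hmem''' 2 (343/400) with hmem'''' | hmem''''
            · rcases Box.mem_split hmem'''' 1 (147/200) with hmem''''' | hmem'''''
              · rcases Box.mem_split hmem''''' 2 (637/800) with hmem'''''' | hmem''''''
                · rcases Box.mem_split hmem'''''' 0 (49/100) with hmem''''''' | hmem'''''''
                  · rcases Box.mem_split hmem''''''' 2 (49/64) with hmem'''''''' | hmem''''''''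
                    · exact inertial_of_cert (D := dY) (k := 14) dY_elimOK_14 cert_dY_Y_hq_14 (by norm_num) hmem'''''''' h0 hc hX hLo hUp hk
                    · exact inertial_of_cert (D := dY) (k := 14) dY_elimOK_14 cert_dY_Y_hq_15 (by norm_num) hmem'''''''' h0 hc hX hLo hUp hk
                  · exact inertial_of_cert (D := dY) (k := 14) dY_elimOK_14 cert_dY_Y_hq_16 (by norm_num) hmem''''''' h0 hc hX hLo hUp hk
                · exact inertial_of_cert (D := dY) (k := 14) dY_elimOK_14 cert_dY_Y_hq_17 (by norm_num) hmem'''''' h0 hc hX hLo hUp hk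
              · exact inertial_of_cert (D := dY) (k := 14) dY_elimOK_14 cert_dY_Y_hq_18 (by norm_num) hmem''''' h0 hc hX hLo hUp hk
            · exact inertial_of_cert (D := dY) (k := 14) dY_elimOK_14 cert_dY_Y_hq_19 (by norm_num) hmem'''' h0 hc hX hLo hUp hk
    · exact inertial_of_cert (D := dY) (k := 15) dY_elimOK_15 cert_dY_Y_cub2b (by norm_num) hmem h0 hc hX hLo hUp hk
    · exact inertial_of_cert (D := dY) (k := 16) dY_elimOK_16 cert_dY_Y_cub1b (by norm_num) hmem h0 hc hX hLo hUp hk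
  · have hB20 : (0 : ℝ) ≤ b ^ 2 := by positivity
    have hB23 : b ^ 2 ≤ 3 := by nlinarith
    fin_cases k
    · exact Spec.face_damping (dY 0) dY_dampOK_0 x (b ^ 2) h0 hB20 hB23 hk
    · exact Spec.face_damping (dY 1) dY_dampOK_1 x (b ^ 2) h0 hB20 hB23 hk
    · exact Spec.face_damping (dY 2) dY_dampOK_2 x (b ^ 2) h0 hB20 hB23 hk
    · exact Spec.face_damping (dY 3) dY_dampOK_3 x (b ^ 2) h0 hB20 hB23 hk
    · exact Spec.face_damping (dY 4) dY_dampOK_4 x (b ^ 2) h0 hB20 hB23 hk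
    · exact Spec.face_damping (dY 5) dY_dampOK_5 x (b ^ 2) h0 hB20 hB23 hk
    · exact damping_of_cert (D := dY) (k := 6) dY_elimOK_6 cert_dY_Y_capA_damp hmem h0 hc hX hLo hUp hk
    · exact Spec.face_damping (dY 7) dY_dampOK_7 x (b ^ 2) h0 hB20 hB23 hk
    · exact damping_of_cert (D := dY) (k := 8) dY_elimOK_8 cert_dY_Y_bulk_damp hmem h0 hc hX hLo hUp hk
    · exact damping_of_cert (D := dY) (k := 9) dY_elimOK_9 cert_dY_Y_carve_damp hmem h0 hc hX hLo hUp hk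
    · exact damping_of_cert (D := dY) (k := 10) dY_elimOK_10 cert_dY_Y_rat0_damp hmem h0 hc hX hLo hUp hk
    · exact damping_of_cert (D := dY) (k := 11) dY_elimOK_11 cert_dY_Y_rat1_damp hmem h0 hc hX hLo hUp hk
    · exact damping_of_cert (D := dY) (k := 12) dY_elimOK_12 cert_dY_Y_rat2_damp hmem h0 hc hX hLo hUp hk
    · exact damping_of_cert (D := dY) (k := 13) dY_elimOK_13 cert_dY_Y_rat3_damp hmem h0 hc hX hLo hUp hk
    · exact damping_of_cert (D := dY) (k := 14) dY_elimOK_14 cert_dY_Y_hq_damp hmem h0 hc hX hLo hUp hk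
    · exact Spec.face_damping (dY 15) dY_dampOK_15 x (b ^ 2) h0 hB20 hB23 hk
    · exact Spec.face_damping (dY 16) dY_dampOK_16 x (b ^ 2) h0 hB20 hB23 hk

/-- **The ν-uniform chain barrier `θ = 101/200` at every `b ∈ [253/200, 127/100]`** (spec-list design `dY`).
[cite: BarbatoMorandinRomito2011, §3.2 (the rescaling)] [cite: Tao2016AveragedNS, §4 (4.5), (4.13)] -/
theorem spec_gap_chain_Y {b c₀ ν s x₀ : ℝ} (hb : (253 / 200 : ℝ) ≤ b) (hb' : b ≤ (127 / 100 : ℝ)) (hc₀ : 0 < c₀)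
    (hν : 0 < ν) (hs : 0 < s) {Z : ℤ → ℝ → ℝ}
    (hdat : ∀ k : ℤ, Z k 0 = if k = 0 then x₀ else 0)
    (hvan : ∀ t, Z (-1) t = 0)
    (hbdd : ∃ M : ℝ, ∀ (t : ℝ) (k : ℕ), (1 + b ^ ((10 : ℝ) * k)) * |Z k t| ≤ M)
    (hcont : ∀ k : ℕ, ContinuousOn (Z k) (Icc 0 s))
    (hode : ∀ k : ℕ, ∀ t ∈ Icc 0 s, HasDerivWithinAt (Z k)
      (c₀ * (b ^ ((5 : ℝ) * ((k : ℝ) - 1) / 2) * Z ((k : ℤ) - 1) t ^ 2 -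
          b ^ ((5 : ℝ) * (k : ℝ) / 2) * (Z k t * Z ((k : ℤ) + 1) t)) -
        ν * b ^ ((2 : ℝ) * (k : ℝ)) * Z k t) (Icc 0 s) t)
    (hnn : ∀ t ∈ Icc 0 s, ∀ k : ℕ, 1 ≤ k → 0 ≤ Z k t) :
    ∀ t ∈ Icc 0 s, ∀ k : ℕ, (b ^ ((101 : ℝ) / 200)) ^ (2 * k) * Z k t ^ 2 ≤ 100 * x₀ ^ 2 :=
  chain_le_of_coupledFaceCertB (g := fun k => (dY k).face) (dg := fun k => (dY k).grad)
    (by linarith) (by linarith) hc₀ (by norm_num : (49 / 50 : ℝ) ≤ 1) hν hs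
    (fun k => (dY k).face_continuous) (fun k => (dY k).face_hasDerivWithinAt)
    (design_init dY dY_initOK) (design_safe dY 2 ((49/50)) rfl (by norm_num)) (specSliceY_hFace hb hb')
    hdat hvan hbdd hcont hode hnn

end Summit.NavierStokesRegularity.NavierStokesRegularity.Theorems.VirtualFloor.GapSpec

end
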